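import Summits.HubbardSuperconductivity.HubbardSuperconductivity.Theses.LevyLogBootstrap
import Summits.HubbardSuperconductivity.HubbardSuperconductivity.Theses.PlaquetteBoson
import Summits.HubbardSuperconductivity.HubbardSuperconductivity.Theorems.CooperPairDMottWalkBreathingAtOneIsPure
import HarnessLib

/-!
# Crux-ideate round 2, ideator k=4 — stmt-HubbardSuperconductivity-0907 (`PbContinuation` ≡
# `LevyLogBootstrap.Continuation`): typed vocabulary for the NODAL WALL on the plaquette path

Companion of `IdeationR2K4.md` (seat `planner-cruxidea-stmt-HubbardSuperconductivity-0907-4-0`,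
2026-08-17). NOT a line (no `stub_*`, no `PbContinuation_of`), NOT a restatement. It records, over the
literal route terms, the one new obstruction of this round:

* `parityGap L t' U δ` — the pair-breaking (fermion-parity) gap of the checkerboard torus
  `H_L(t',U)` at doping `δ`: `E₀(N+1, S^z=½) + E₀(N-1, S^z=-½) - 2·E₀(N, S^z=0)`, `N = 2⌊(1-δ)L²/2⌋`
  (sector minima `Matrix.minEnergyOn` over `szSector`);
* `GappedOddSectorPath U δ t₁` — an `L`-uniform lower bound on that gap on the CLOSED segment
  `t' ∈ [t₁, 1]` (the hypothesis every gap-protected / quasi-adiabatic / cluster-expansion continuation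
  of the anchor's order would need, even after the `U(1)` Goldstone mode is gapped by a `d`-wave source,
  because a `B₁g` source vanishes on the zone diagonals and does not gap the nodes);
* `NodalEndpoint U δ` — the uniform point is gapless in the odd sector along `L ∈ 4ℕ` (symmetry-protected
  `d_{x²-y²}` nodes: Volovik, cond-mat/0505089 §4.2, winding number `N₂ = ±1` under time reversal;
  BEC→BCS node nucleation: Duncan–Sá de Melo PRB 62 (2000) 9675, Botelho–Sá de Melo PRB 71 (2005) 134507);
* `not_gappedOddSectorPath_of_nodalEndpoint` — the (trivial, kernel-checked) incompatibility: a nodal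
  endpoint kills the gapped-path hypothesis for EVERY `t₁ ≤ 1`; together with the BEC-side gap
  (`BecSideGapped`, plaquette pair binding, expected for `0 < U < U_c ≈ 4.58`) the path must CLOSE the
  odd-sector gap somewhere in `(t₁, 1]` — a Lifshitz-type quantum phase transition on every plaquette
  path ending at a `d_{x²-y²}` point of the pure model, in the window of every proposed restatement
  (R3 window, R5 ray, R1 ∃→∃) as much as in the crux as typed.
* `checker_one` — endpoint identity (landed `hamiltonian_sdiff_add_inf`), so `parityGap L 1 U δ` is a
  statement about `hubbardTorus 2 L 1 U`.

Physical status of the two named hypotheses: `BecSideGapped` and `NodalEndpoint` are conjectures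
(tagged), not theorems; the lemma is bookkeeping. Nothing here bears on the truth of the crux; it bears
on which proof ARCHITECTURES can exist for it (see the .md, §3).
-/

noncomputable section

set_option linter.dupNamespace false

namespace Summit.HubbardSuperconductivity.HubbardSuperconductivity.Cruxes.PbContinuation.IdeationR2K4

open Matrix Filter
open Literature.Probability.LatticeModels Literature.MathematicalPhysics.QuantumLattice

/-- The checkerboard (plaquette / breathing) Hubbard torus `H_L(t',U)` (verbatim from the crux).
[folklore] -/
def checker (L : ℕ) [NeZero L] (t' U : ℝ) :
    Matrix (Finset (Orb (FermionTorus 2 L))) (Finset (Orb (FermionTorus 2 L))) ℂ :=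
  hamiltonian ((fermionTorusGraph 2 L) \ SimpleGraph.comap
      (fun x : FermionTorus 2 L => fun i : Fin 2 => ((ofLex x) i : ℕ) / 2) ⊤) 1 U +
    hamiltonian ((fermionTorusGraph 2 L) ⊓ SimpleGraph.comap
      (fun x : FermionTorus 2 L => fun i : Fin 2 => ((ofLex x) i : ℕ) / 2) ⊤) t' 0

/-- ENDPOINT IDENTITY: `H_L(1,U)` is the pure Hubbard torus (landed edge partition). [folklore] -/
theorem checker_one (L : ℕ) [NeZero L] (U : ℝ) : checker L 1 U = hubbardTorus 2 L 1 U :=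
  Summit.HubbardSuperconductivity.HubbardSuperconductivity.Theorems.CooperPairDMottWalk.hamiltonian_sdiff_add_inf
    _ _ 1 U

/-- The crux's electron number at hole doping `δ` on the torus of side `L`. [folklore] -/
def electronNumber (δ : ℝ) (L : ℕ) : ℕ := 2 * ⌊(1 - δ) * (L : ℝ) ^ 2 / 2⌋₊

/-- PAIR-BREAKING (fermion-parity) GAP of `H_L(t',U)` at doping `δ`:
`E₀(N+1, ½) + E₀(N-1, -½) - 2 E₀(N, 0)` with sector floors `minEnergyOn (szSector · ·)`.
At `t' = 0` it is the plaquette pair-binding energy `2E(3) - E(2) - E(4)` (Tsai–Kivelson 2006,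
Yao–Tsai–Kivelson 2007); at `t' = 1` it is the two-sided single-particle gap of the pure torus.
Junk value at `N = 0` (truncated subtraction), never met for `δ < 1`, `L ≥ 2`. [folklore] -/
def parityGap (L : ℕ) [NeZero L] (t' U δ : ℝ) : ℝ :=
  (checker L t' U).minEnergyOn (szSector (electronNumber δ L + 1) (1/2)) +
    (checker L t' U).minEnergyOn (szSector (electronNumber δ L - 1) (-1/2)) -
      2 * (checker L t' U).minEnergyOn (szSector (electronNumber δ L) 0)

/-- GAPPED ODD-SECTOR PATH: an `L`-uniform lower bound on the parity gap on the CLOSED segment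
`t' ∈ [t₁, 1]`, eventually in `L ∈ 4ℕ` — the input of every gap-protected continuation architecture
(quasi-adiabatic flow, Bravyi–Hastings–Michalakis / Michalakis–Zwolak stability, De Roeck–Salmhofer /
Hastings free-fermion stability, cluster expansions about a gapped BdG state). [folklore] -/
def GappedOddSectorPath (U δ t₁ : ℝ) : Prop :=
  ∃ γ : ℝ, 0 < γ ∧ ∃ L₀ : ℕ, ∀ (L : ℕ) [NeZero L], L₀ ≤ L → 4 ∣ L →
    ∀ t' ∈ Set.Icc t₁ 1, γ ≤ parityGap L t' U δ

/-- NODAL ENDPOINT (conjecture, physical): at a `d_{x²-y²}` point `(U,δ)` of the PURE torus the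
parity gap is not bounded below along `L ∈ 4ℕ` — four symmetry-protected gap nodes on the zone
diagonals (the `B₁g` form factor vanishes there and the normal-state Fermi line at density `1-δ ∈
(1/2,1)` crosses the diagonals), finite-size gap `O(1/L)`. Volovik cond-mat/0505089 §4.2 (winding
`N₂ = ±1`, stable under time reversal); Duncan–Sá de Melo 2000; Botelho–Sá de Melo 2005. [conjecture] -/
def NodalEndpoint (U δ : ℝ) : Prop :=
  ∀ γ : ℝ, 0 < γ → ∀ L₀ : ℕ, ∃ (L : ℕ) (_ : NeZero L), L₀ ≤ L ∧ 4 ∣ L ∧ parityGap L 1 U δ < γ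

/-- BEC-SIDE GAP (conjecture, physical): for `0 < U < U_c ≈ 4.58` (plaquette pair binding) the parity
gap stays `≥ γ(U) > 0` for all sufficiently small `t'`, uniformly in `L ∈ 4ℕ` (all fermionic
excitations of the plaquette-pair condensate cost the pair-binding energy; the gapless modes are
bosonic). Yao–Tsai–Kivelson 2007 pp. 2–3. [conjecture] -/
def BecSideGapped (U δ : ℝ) : Prop :=
  ∃ t₁ : ℝ, 0 < t₁ ∧ ∃ γ : ℝ, 0 < γ ∧ ∃ L₀ : ℕ, ∀ (L : ℕ) [NeZero L], L₀ ≤ L → 4 ∣ L →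
    ∀ t' ∈ Set.Ioc 0 t₁, γ ≤ parityGap L t' U δ

/-- **The wall, bookkeeping half (kernel-checked).** A nodal endpoint is incompatible with a gapped
odd-sector path on `[t₁,1]` for every `t₁ ≤ 1`: no gap-protected continuation architecture reaches the
uniform point. [folklore] -/
theorem not_gappedOddSectorPath_of_nodalEndpoint {U δ t₁ : ℝ} (ht₁ : t₁ ≤ 1)
    (h : NodalEndpoint U δ) : ¬ GappedOddSectorPath U δ t₁ := by
  rintro ⟨γ, hγ, L₀, hL⟩
  obtain ⟨L, hNZ, hL₀, h4, hlt⟩ := h γ hγ L₀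
  have hle := @hL L hNZ hL₀ h4 1 ⟨ht₁, le_refl 1⟩
  exact absurd hle (not_le.mpr hlt)

/-- **The wall, physical half (typed consequence of the two conjectures).** If the BEC side is gapped
and the endpoint is nodal, then the parity gap is `≥ γ` near `t' = 0` yet NOT bounded below on any
closed segment reaching `t' = 1`: the odd-sector gap closes somewhere on the path (a Lifshitz-type
quantum phase transition between a nodeless and a nodal paired state). Recorded as the conjunction it
is; both hypotheses are open. [conjecture] -/
theorem wall_of_becSideGapped_of_nodalEndpoint {U δ : ℝ}
    (hB : BecSideGapped U δ) (hN : NodalEndpoint U δ) :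
    (∃ t₁ : ℝ, 0 < t₁ ∧ ∃ γ : ℝ, 0 < γ ∧ ∃ L₀ : ℕ, ∀ (L : ℕ) [NeZero L], L₀ ≤ L → 4 ∣ L →
        ∀ t' ∈ Set.Ioc 0 t₁, γ ≤ parityGap L t' U δ) ∧
      ∀ t₁ : ℝ, t₁ ≤ 1 → ¬ GappedOddSectorPath U δ t₁ :=
  ⟨hB, fun _ ht₁ => not_gappedOddSectorPath_of_nodalEndpoint ht₁ hN⟩

/-- Sanity: the gapped-path predicate is antitone in its left end (a gap on `[t₁,1]` gives one on
`[t₂,1]` for `t₁ ≤ t₂`), so the wall statement for all `t₁ ≤ 1` is equivalent to its instances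
`t₁ ↑ 1`: what fails is the gap AT AND NEAR the uniform point, uniformly in `L`. [folklore] -/
theorem gappedOddSectorPath_mono {U δ t₁ t₂ : ℝ} (h12 : t₁ ≤ t₂)
    (h : GappedOddSectorPath U δ t₁) : GappedOddSectorPath U δ t₂ := by
  obtain ⟨γ, hγ, L₀, hL⟩ := h
  refine ⟨γ, hγ, L₀, fun L _ hL₀ h4 t' ht' => hL L hL₀ h4 t' ⟨le_trans h12 ht'.1, ht'.2⟩⟩

end Summit.HubbardSuperconductivity.HubbardSuperconductivity.Cruxes.PbContinuation.IdeationR2K4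

end
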